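import Literature.Topology.FourManifolds.FramedLinkTraceSimplyConnected
import Literature.AlgebraicTopology.SingularHomology.MayerVietorisEuler
import Literature.AlgebraicTopology.SingularHomology.CellsAttachmentEuler
import Literature.AlgebraicTopology.SingularHomology.DeformationRetractHomology
import HarnessLib

/-!
# The Euler characteristic of the trace `B⁴ ∪_L (2-handles)` of an `n`-component framed link
# is `n + 1`

Topic `Literature/Topology/FourManifolds`.  Gompf–Stipsicz, *4-Manifolds and Kirby Calculus*
(1999), §4.2 (p. 111): a handlebody has the homotopy type of a CW complex with one `k`-cell per
`k`-handle, so `χ = Σ (-1)ᵏ (#k-handles)`; for the `2`-handlebody `X_L = D⁴ ∪_L (2-handles)` of an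
`n`-component framed link, `χ(X_L) = 1 + n` (Kirby, *The Topology of 4-Manifolds* (1989), Ch. I
§2; the count "`Σ` has Euler characteristic `2`" in the proof of Prop. 9.2 of
Gompf–Scharlemann–Thompson, Geom. Topol. 14 (2010), arXiv:1103.1601 p. 20).  This file proves it
for the tree's compact trace `FramedLink.IsTrace L P` (`RLinkSphere.lean`), together with the
finiteness of `H_•(P; ℤ)`, by Mayer–Vietoris on Kosinski's open cover of `P`
(`HandleAttachingMaps.lean`, Kosinski 1993, VI §6): the base piece `D⁴ ∖ ⋃ cores` and the handle
pieces `D⁴ ∖ S` are contractible (`χ = 1`) and the `j`-th handle piece meets the base piece in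
the punctured tube `T ∖ S ≃ S¹` (`χ = 0`), so `χ(P) = 1 + n · (1 - 0)`.

* `finRelHomology_handleTube₄_lamSq_ne_one`, `finRelHomology_beltPiece₄_lamSq_ne_zero` — the
  punctured tube `T ∖ S` (in the tube, and read in the handle piece) has finitely generated
  integral homology and `χ = 0` (it deformation retracts onto a parallel circle,
  `isStrongDeformationRetractOf_parallel₄_of_lt`);
* `DottedCircleDiagram.Realization.finRelHomology_of_ofFramedLink`,
  **`FramedLink.IsTrace.finRelHomology`**, **`FramedLink.IsTrace.relEuler_eq`** —
  `H_•(P; ℤ)` is finitely generated and `χ(P) = 1 + n`.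

Everything is proved; no definitions, no named facts.

## References

* R. E. Gompf, A. I. Stipsicz, *4-Manifolds and Kirby Calculus*, GSM 20 (1999), §4.2 p. 111,
  §4.4. [GompfStipsicz1999]
* R. C. Kirby, *The Topology of 4-Manifolds*, LNM 1374 (1989), Ch. I §2. [Kirby1989]
* R. E. Gompf, M. Scharlemann, A. Thompson, Geom. Topol. 14 (2010), proof of Prop. 9.2
  (arXiv:1103.1601, p. 20). [GompfScharlemannThompson2010]
* A. A. Kosinski, *Differential Manifolds* (1993), VI §6. [Kosinski1993]
* A. Hatcher, *Algebraic Topology* (2002), §2.2 pp. 149–150, Thm. 2.44. [HatcherAT2002]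
-/

open scoped Manifold ContDiff Topology
open Set Function Metric Topology CategoryTheory Limits

noncomputable section

namespace Literature.Topology.FourManifolds

open Literature.AlgebraicTopology.SingularHomology Literature.AlgebraicTopology.Homotopy
open Literature.AlgebraicTopology.FundamentalGroup.VanKampen HandleShrink

universe u v w

/-! ### §1 The punctured tube `T ∖ S` has the Euler characteristic of a circle -/

section Tube

/-- **The parallel circle `K_c = {|x_λ| = c, x_μ = 0}` of the tube is a circle**: the map
`θ ↦ (c θ, 0)` is a homeomorphism of `S¹` onto it (`0 < c ≤ 1`). [cite: Kosinski1993, VI §6] -/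
theorem nonempty_sphere_homeomorph_parallel₄ {c : ℝ} (hc : 0 < c) (hc1 : c ≤ 1) :
    Nonempty (↥(sphere (0 : EuclideanSpace ℝ (Fin 2)) 1) ≃ₜ
      ↥{y : ↥(handleTube 3 2) | lamSq 2 y.1.1 = c ^ 2 ∧ muSq 2 y.1.1 = 0}) := by
  -- the circle map (as in `isPathConnected_parallel₄`)
  have hmem₁ : ∀ θ : sphere (0 : EuclideanSpace ℝ (Fin 2)) 1,
      c • corePt θ ∈ closedBall (0 : EuclideanSpace ℝ (Fin 4)) 1 := fun θ => by
    rw [mem_closedBall_zero_iff, norm_smul, norm_corePt, mul_one, Real.norm_eq_abs, abs_of_pos hc]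
    exact hc1
  have hlam₁ : ∀ θ : sphere (0 : EuclideanSpace ℝ (Fin 2)) 1, lamSq 2 (c • corePt θ) = c ^ 2 :=
    fun θ => by rw [lamSq_smul, lamSq_corePt, mul_one]
  have hmem₂ : ∀ θ : sphere (0 : EuclideanSpace ℝ (Fin 2)) 1,
      (⟨c • corePt θ, hmem₁ θ⟩ : closedBall (0 : EuclideanSpace ℝ (Fin 4)) 1) ∈ handleTube 3 2 :=
    fun θ => by
      rw [mem_handleTube]
      show lamSq 2 (c • corePt θ) ≠ 0
      rw [hlam₁]; positivity
  set γ : sphere (0 : EuclideanSpace ℝ (Fin 2)) 1 → ↥(handleTube 3 2) := fun θ =>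
    ⟨⟨c • corePt θ, hmem₁ θ⟩, hmem₂ θ⟩ with hγ
  have hγc : Continuous γ := ((continuous_corePt.const_smul c).subtype_mk _).subtype_mk _
  have hγi : Injective γ := fun θ θ' h => by
    have h' : c • corePt θ = c • corePt θ' := congrArg (fun y : ↥(handleTube 3 2) => y.1.1) h
    exact injective_corePt (smul_right_injective _ hc.ne' h')
  have hrange : range γ = {y : ↥(handleTube 3 2) | lamSq 2 y.1.1 = c ^ 2 ∧ muSq 2 y.1.1 = 0} := by
    ext y
    constructor
    · rintro ⟨θ, rfl⟩
      refine ⟨hlam₁ θ, ?_⟩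
      show muSq 2 (c • corePt θ) = 0
      rw [← blockScale_self_eq_smul, muSq_blockScale, muSq_corePt, mul_zero]
    · rintro ⟨hl, hm⟩
      set u : EuclideanSpace ℝ (Fin 4) := y.1.1 with hu
      have h2 : u 2 = 0 := apply_eq_zero_of_muSq_eq_zero hm (i := 2) (by norm_num)
      have h3 : u 3 = 0 := apply_eq_zero_of_muSq_eq_zero hm (i := 3) (by norm_num)
      rw [lamSq_two_fin_four] at hl
      let v : EuclideanSpace ℝ (Fin 2) := WithLp.toLp 2 ![u 0 / c, u 1 / c]
      have hv : ‖v‖ = 1 := by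
        have : ‖v‖ ^ 2 = 1 := by
          rw [EuclideanSpace.norm_sq_eq, Fin.sum_univ_two, Real.norm_eq_abs, Real.norm_eq_abs,
            sq_abs, sq_abs]
          simp only [v]
          rw [Matrix.cons_val_zero, Matrix.cons_val_one, Matrix.cons_val_zero, div_pow, div_pow,
            ← add_div, hl, div_self (pow_pos hc 2).ne']
        nlinarith [norm_nonneg v]
      refine ⟨⟨v, mem_sphere_zero_iff_norm.2 hv⟩, ?_⟩
      apply Subtype.ext; apply Subtype.ext
      show c • corePt _ = u
      ext i
      fin_cases i
      · show c * (u 0 / c) = u 0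
        field_simp
      · show c * (u 1 / c) = u 1
        field_simp
      · show c * 0 = u 2
        rw [h2, mul_zero]
      · show c * 0 = u 3
        rw [h3, mul_zero]
  have hce : IsClosedEmbedding γ := hγc.isClosedEmbedding hγi
  exact ⟨hce.isEmbedding.toHomeomorph.trans (Homeomorph.setCongr hrange)⟩

/-- The parallel circle `K_{1/2}` has finitely generated integral homology (zero from degree `3`
on) and Euler characteristic `0` (it is a circle, `χ(S¹) = 0`).
[cite: HatcherAT2002, Example 2.17 (p. 118), with Cor. 2.14] -/
theorem finRelHomology_parallel₄ :
    FinRelHomology ℤ ℤ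
        ↥{y : ↥(handleTube 3 2) | lamSq 2 y.1.1 = (2⁻¹ : ℝ) ^ 2 ∧ muSq 2 y.1.1 = 0} ∅ 3 ∧
      relEuler ℤ ℤ ↥{y : ↥(handleTube 3 2) | lamSq 2 y.1.1 = (2⁻¹ : ℝ) ^ 2 ∧ muSq 2 y.1.1 = 0} ∅
        = 0 := by
  obtain ⟨e⟩ := nonempty_sphere_homeomorph_parallel₄ (c := 2⁻¹) (by norm_num) (by norm_num)
  let e₀ : ↥(Subtype.val ⁻¹' sphere (0 : EuclideanSpace ℝ (Fin 2)) 1 :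
      Set ↥(closedBall (0 : EuclideanSpace ℝ (Fin 2)) 1)) ≃ₜ
      ↥(sphere (0 : EuclideanSpace ℝ (Fin 2)) 1) :=
    SphereComplement.preimageValHomeomorphOfSubset sphere_subset_closedBall
  obtain ⟨h, hχ⟩ := finRelHomology_of_homeomorph_boundarySphere ℤ ℤ (k := 2) (e₀.trans e)
  refine ⟨h, ?_⟩
  rw [hχ, Module.finrank_self]
  norm_num

/-- **The punctured tube `T ∖ S` has finitely generated integral homology and `χ(T ∖ S) = 0`**:
it deformation retracts onto the parallel circle `K_{1/2}`
(`isStrongDeformationRetractOf_parallel₄_of_lt`; Hatcher 2002, Prop. 2.19 / Cor. 2.11).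
[cite: Kosinski1993, VI §6] [cite: HatcherAT2002, Cor. 2.11] -/
theorem finRelHomology_handleTube₄_lamSq_ne_one :
    FinRelHomology ℤ ℤ ↥{y : ↥(handleTube 3 2) | lamSq 2 y.1.1 ≠ 1} ∅ 3 ∧
      relEuler ℤ ℤ ↥{y : ↥(handleTube 3 2) | lamSq 2 y.1.1 ≠ 1} ∅ = 0 := by
  set TS : Set ↥(handleTube 3 2) := {y | lamSq 2 y.1.1 ≠ 1} with hTS
  set K : Set ↥(handleTube 3 2) := {y | lamSq 2 y.1.1 = (2⁻¹ : ℝ) ^ 2 ∧ muSq 2 y.1.1 = 0} with hK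
  have hKTS : K ⊆ TS := by
    rintro z ⟨hz, -⟩
    show lamSq 2 z.1.1 ≠ 1
    rw [hz]; norm_num
  have hsdr : IsStrongDeformationRetractOf K TS :=
    isStrongDeformationRetractOf_parallel₄_of_lt (c := 2⁻¹) (by norm_num) (by norm_num)
  obtain ⟨hKf, hKχ⟩ := finRelHomology_parallel₄
  have e : ∀ k, relativeSingularHomology ℤ ℤ ↥K ∅ k ≅ relativeSingularHomology ℤ ℤ ↥TS ∅ k :=
    fun k => hsdr.relativeSingularHomologyIso ℤ ℤ hKTS (empty_subset K) k
  exact ⟨hKf.of_iso e, (relEuler_eq_of_iso e).symm.trans hKχ⟩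

/-- The punctured tube read in the handle piece, `{x ∈ D⁴ ∖ S | x_λ ≠ 0}` — the region along
which a `2`-handle is glued to the manifold — has finitely generated integral homology and Euler
characteristic `0`. [cite: Kosinski1993, VI §6] -/
theorem finRelHomology_beltPiece₄_lamSq_ne_zero :
    FinRelHomology ℤ ℤ ↥{b : ↥(beltPiece 3 2) | lamSq 2 b.1.1 ≠ 0} ∅ 3 ∧
      relEuler ℤ ℤ ↥{b : ↥(beltPiece 3 2) | lamSq 2 b.1.1 ≠ 0} ∅ = 0 := by
  -- `{b ∈ D⁴ ∖ S | x_λ ≠ 0}` and `{y ∈ T | |y_λ| ≠ 1}` are the same subset of `D⁴`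
  let e : ↥{y : ↥(handleTube 3 2) | lamSq 2 y.1.1 ≠ 1} ≃ₜ
      ↥{b : ↥(beltPiece 3 2) | lamSq 2 b.1.1 ≠ 0} :=
    { toFun := fun y => ⟨⟨y.1.1, y.2⟩, y.1.2⟩
      invFun := fun b => ⟨⟨b.1.1, b.2⟩, b.1.2⟩
      left_inv := fun _ => rfl
      right_inv := fun _ => rfl
      continuous_toFun := by fun_prop
      continuous_invFun := by fun_prop }
  obtain ⟨hf, hχ⟩ := finRelHomology_handleTube₄_lamSq_ne_one
  exact ⟨hf.of_homeomorph e (mapsTo_empty _ _) (mapsTo_empty _ _),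
    (relEuler_eq_of_homeomorph e (mapsTo_empty _ _) (mapsTo_empty _ _)).symm.trans hχ⟩

end Tube

/-! ### §2 The pieces of the trace -/

namespace DottedCircleDiagram.Realization

variable {κ : Type v} [Finite κ] {L : FramedLink κ} {P : Type w} [TopologicalSpace P]
  [ChartedSpace (EuclideanHalfSpace 4) P] (R : (ofFramedLink L).Realization P)

/-- The base piece `glued(D⁴ ∖ ⋃ cores)` of the trace is contractible.
[cite: HatcherAT2002, Ch. 0 (p. 4)] -/
theorem contractibleSpace_range_glued : ContractibleSpace ↥(range R.glued) := by
  haveI := R.contractibleSpace_coresComplement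
  exact R.isSmoothEmbedding_glued.isEmbedding.toHomeomorph.toHomotopyEquiv.contractibleSpace_iff.1
    inferInstance

/-- Each handle piece `D⁴ ∖ S` of the trace is contractible. [cite: HatcherAT2002, Ch. 0 (p. 4)] -/
theorem contractibleSpace_range_handlePiece (j : κ) :
    ContractibleSpace ↥(range (R.handlePiece j)) := by
  haveI := contractibleSpace_beltPiece₄
  exact (R.isSmoothEmbedding_handlePiece j).isEmbedding.toHomeomorph.toHomotopyEquiv
    |>.contractibleSpace_iff.1 inferInstance

/-- The base piece: finitely generated homology, `χ = 1`. [cite: HatcherAT2002, Prop. 2.7] -/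
theorem finRelHomology_range_glued :
    FinRelHomology ℤ ℤ ↥(range R.glued) ∅ 1 ∧ relEuler ℤ ℤ ↥(range R.glued) ∅ = 1 := by
  haveI := R.contractibleSpace_range_glued
  exact ⟨finRelHomology_empty_of_contractibleSpace ℤ ℤ,
    (relEuler_empty_of_contractibleSpace ℤ ℤ).trans (by rw [Module.finrank_self]; rfl)⟩

/-- A handle piece: finitely generated homology, `χ = 1`. [cite: HatcherAT2002, Prop. 2.7] -/
theorem finRelHomology_range_handlePiece (j : κ) :
    FinRelHomology ℤ ℤ ↥(range (R.handlePiece j)) ∅ 1 ∧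
      relEuler ℤ ℤ ↥(range (R.handlePiece j)) ∅ = 1 := by
  haveI := R.contractibleSpace_range_handlePiece j
  exact ⟨finRelHomology_empty_of_contractibleSpace ℤ ℤ,
    (relEuler_empty_of_contractibleSpace ℤ ℤ).trans (by rw [Module.finrank_self]; rfl)⟩

/-- The gluing region of the `j`-th handle: finitely generated homology, `χ = 0` (it is the
punctured tube `T ∖ S ≃ S¹`). [cite: Kosinski1993, VI §6] -/
theorem finRelHomology_range_glued_inter (j : κ) :
    FinRelHomology ℤ ℤ ↥(range R.glued ∩ range (R.handlePiece j)) ∅ 3 ∧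
      relEuler ℤ ℤ ↥(range R.glued ∩ range (R.handlePiece j)) ∅ = 0 := by
  have heq := HandleAttachingMap.IsMultiAttachment.range_jA_inter_range_jB R.disjoint_handle
    R.glued_eq_handlePiece_iff j
  have hemb := (R.isSmoothEmbedding_handlePiece j).isEmbedding
  -- the gluing region is the homeomorphic image of `{b ∈ D⁴ ∖ S | x_λ ≠ 0}`
  let e : ↥{b : ↥(beltPiece 3 2) | lamSq 2 b.1.1 ≠ 0} ≃ₜ
      ↥(range R.glued ∩ range (R.handlePiece j)) :=
    (hemb.comp IsEmbedding.subtypeVal).toHomeomorph.trans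
      (Homeomorph.setCongr (by rw [heq, range_comp, Subtype.range_coe]))
  obtain ⟨hf, hχ⟩ := finRelHomology_beltPiece₄_lamSq_ne_zero
  exact ⟨hf.of_homeomorph e (mapsTo_empty _ _) (mapsTo_empty _ _),
    (relEuler_eq_of_homeomorph e (mapsTo_empty _ _) (mapsTo_empty _ _)).symm.trans hχ⟩

/-! ### §3 Mayer–Vietoris, one handle at a time -/

/-- **Adding the handles one at a time**: for every finite set `s` of handles, the open piece
`glued(D⁴ ∖ ⋃ cores) ∪ ⋃_{j ∈ s} handlePieceⱼ(D⁴ ∖ S)` of the trace has finitely generated integral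
homology, zero from degree `#s + 3` on, and Euler characteristic `1 + #s` (Mayer–Vietoris,
`finRelHomology_union_of_isOpen`: each new handle piece is contractible and meets the previous
union in its gluing region, of Euler characteristic `0`). [cite: GompfStipsicz1999, §4.2 p. 111]
[cite: HatcherAT2002, §2.2 pp. 149–150] -/
theorem finRelHomology_range_glued_union_biUnion (s : Finset κ) :
    FinRelHomology ℤ ℤ ↥(range R.glued ∪ ⋃ j ∈ s, range (R.handlePiece j)) ∅ (s.card + 3) ∧
      relEuler ℤ ℤ ↥(range R.glued ∪ ⋃ j ∈ s, range (R.handlePiece j)) ∅ = 1 + s.card := by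
  classical
  induction s using Finset.induction_on with
  | empty =>
    have hset : range R.glued ∪ ⋃ j ∈ (∅ : Finset κ), range (R.handlePiece j) = range R.glued := by
      simp
    let e : ↥(range R.glued) ≃ₜ ↥(range R.glued ∪ ⋃ j ∈ (∅ : Finset κ), range (R.handlePiece j)) :=
      Homeomorph.setCongr hset.symm
    obtain ⟨hf, hχ⟩ := R.finRelHomology_range_glued
    refine ⟨(hf.of_homeomorph e (mapsTo_empty _ _) (mapsTo_empty _ _)).mono (by simp), ?_⟩
    rw [← relEuler_eq_of_homeomorph (R := ℤ) (M := ℤ) e (mapsTo_empty _ _) (mapsTo_empty _ _), hχ]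
    simp
  | insert i s hi ih =>
    obtain ⟨ihf, ihχ⟩ := ih
    set A : Set P := range R.glued ∪ ⋃ j ∈ s, range (R.handlePiece j) with hA
    set B : Set P := range (R.handlePiece i) with hB
    have hAo : IsOpen A := isOpen_union_biUnion R.isOpen_range_glued R.isOpen_range_handlePiece s
    have hBo : IsOpen B := R.isOpen_range_handlePiece i
    have hAB : A ∩ B = range R.glued ∩ range (R.handlePiece i) :=
      union_biUnion_inter_eq R.disjoint_handlePiece hi
    -- the three inputs of Mayer–Vietoris, all with the bound `#s + 3`
    have hfA : FinRelHomology ℤ ℤ ↥A ∅ (s.card + 3) := ihf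
    have hfB : FinRelHomology ℤ ℤ ↥B ∅ (s.card + 3) :=
      (R.finRelHomology_range_handlePiece i).1.mono (by omega)
    obtain ⟨hfI, hχI⟩ := R.finRelHomology_range_glued_inter i
    let eI : ↥(range R.glued ∩ range (R.handlePiece i)) ≃ₜ ↥(A ∩ B) := Homeomorph.setCongr hAB.symm
    have hfAB : FinRelHomology ℤ ℤ ↥(A ∩ B) ∅ (s.card + 3) :=
      (hfI.of_homeomorph eI (mapsTo_empty _ _) (mapsTo_empty _ _)).mono (by omega)
    have hχAB : relEuler ℤ ℤ ↥(A ∩ B) ∅ = 0 := by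
      rw [← relEuler_eq_of_homeomorph (R := ℤ) (M := ℤ) eI (mapsTo_empty _ _) (mapsTo_empty _ _),
        hχI]
    obtain ⟨hf, hχ⟩ := finRelHomology_union_of_isOpen ℤ ℤ hAo hBo hfA hfB hfAB
    -- `A ∪ B` is the union over `insert i s`
    have hset : A ∪ B = range R.glued ∪ ⋃ j ∈ insert i s, range (R.handlePiece j) := by
      rw [Finset.set_biUnion_insert, hA, hB, union_assoc,
        union_comm (⋃ j ∈ s, range (R.handlePiece j))]
    let e : ↥(A ∪ B) ≃ₜ ↥(range R.glued ∪ ⋃ j ∈ insert i s, range (R.handlePiece j)) :=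
      Homeomorph.setCongr hset
    refine ⟨?_, ?_⟩
    · rw [Finset.card_insert_of_notMem hi, show s.card + 1 + 3 = s.card + 3 + 1 by ring]
      exact hf.of_homeomorph e (mapsTo_empty _ _) (mapsTo_empty _ _)
    · rw [← relEuler_eq_of_homeomorph (R := ℤ) (M := ℤ) e (mapsTo_empty _ _) (mapsTo_empty _ _),
        Finset.card_insert_of_notMem hi]
      have hχB := (R.finRelHomology_range_handlePiece i).2
      push_cast
      linarith

/-- **The `4`-manifold presented by a Kirby diagram without dotted circles and `n` framed
components has finitely generated integral homology and Euler characteristic `1 + n`**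
(Gompf–Stipsicz 1999, §4.2 p. 111: `χ = Σ (-1)ᵏ #(k-handles)`; here one `0`-handle and `n`
`2`-handles). [cite: GompfStipsicz1999, §4.2 p. 111] [cite: Kirby1989, Ch. I §2] -/
theorem finRelHomology_of_ofFramedLink [Fintype κ] (R : (ofFramedLink L).Realization P) :
    FinRelHomology ℤ ℤ P ∅ (Fintype.card κ + 3) ∧ relEuler ℤ ℤ P ∅ = 1 + Fintype.card κ := by
  classical
  obtain ⟨hf, hχ⟩ := R.finRelHomology_range_glued_union_biUnion Finset.univ
  have hset : range R.glued ∪ ⋃ j ∈ (Finset.univ : Finset κ), range (R.handlePiece j) = univ := by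
    rw [← R.cover]
    congr 1
    ext p
    simp
  let e : ↥(range R.glued ∪ ⋃ j ∈ (Finset.univ : Finset κ), range (R.handlePiece j)) ≃ₜ P :=
    (Homeomorph.setCongr hset).trans (Homeomorph.Set.univ P)
  refine ⟨?_, ?_⟩
  · rw [← Finset.card_univ]
    exact hf.of_homeomorph e (mapsTo_empty _ _) (mapsTo_empty _ _)
  · rw [← relEuler_eq_of_homeomorph (R := ℤ) (M := ℤ) e (mapsTo_empty _ _) (mapsTo_empty _ _), hχ,
      Finset.card_univ]

end DottedCircleDiagram.Realization

/-! ### §4 The trace of a framed link -/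

namespace FramedLink

variable {ι : Type v} [Fintype ι] {L : FramedLink ι} {P : Type w} [TopologicalSpace P]
  [ChartedSpace (EuclideanHalfSpace 4) P]

/-- **The trace of a framed link has finitely generated integral homology, zero in high degrees,
and Euler characteristic `1 + #components`** (one `0`-handle and one `2`-handle per component;
Gompf–Stipsicz 1999, §4.2 p. 111; Kirby 1989, Ch. I §2). [cite: GompfStipsicz1999, §4.2 p. 111]
[cite: Kirby1989, Ch. I §2] -/
theorem IsTrace.finRelHomology (h : L.IsTrace P) :
    FinRelHomology ℤ ℤ P ∅ (Fintype.card ι + 3) ∧ relEuler ℤ ℤ P ∅ = 1 + Fintype.card ι := by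
  obtain ⟨R⟩ := h
  exact R.finRelHomology_of_ofFramedLink

/-- **`χ(B⁴ ∪_L (2-handles)) = n + 1` for an `n`-component framed link `L`** (Gompf–Stipsicz 1999,
§4.2 p. 111; the handle count behind "`Σ` has Euler characteristic `2`" in the proof of Prop. 9.2
of Gompf–Scharlemann–Thompson 2010). [cite: GompfStipsicz1999, §4.2 p. 111]
[cite: GompfScharlemannThompson2010, proof of Prop. 9.2 (arXiv p. 20)] -/
theorem IsTrace.relEuler_eq {n : ℕ} {L : FramedLink (Fin n)} (h : L.IsTrace P) :
    relEuler ℤ ℤ P ∅ = n + 1 := by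
  rw [h.finRelHomology.2, Fintype.card_fin]
  ring

end FramedLink

end Literature.Topology.FourManifolds
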